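import Summits.KontsevichZagierPeriods.KontsevichZagierPeriods.Theorems.PentagonInKZ.Negative.Dispensable

/-!
# `PentagonInKZ` (stmt-KontsevichZagierPeriods-11348) — negative knowledge, part 6: the crux is the pentagon for the rules associator

`pentagonInKZ_iff_rulesAssociator : PentagonInKZ ↔ NCSeries.DrinfeldPentagon KZ.rulesAssociator`
— the realisation form of the crux is equivalent to Drinfeld's pentagon for the rules associator
`Φ_P` over `P_ℚ = ℚ ⊗ (FormalRep ⧸ relations)` of `KZRulesAssociator.lean` (tree-visible
re-derivation of the planner's evidence-only `Equiv2.lean`).  (⇒) the universal realisation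
`chiUniv : FormalRep → P_ℚ` is a realisation whose series is `Φ_P` (`cruxSeries_chiUniv`);
(⇐) every realisation `χ` factors as `descendQ χ ∘ chiUniv` (`descend`, `descendQ`), the series
is natural in `χ` (`cruxSeries_comp`) and the pentagon is preserved by change of coefficients.
Consequence: provers may work over `P_ℚ`; refuters need `Φ_P` to violate the pentagon in some
weight, i.e. (part 4) a counterexample to the kernel conjecture. [cite: Furusho2011, §2; Furusho2003, Prop. 3.2.3]
-/

noncomputable section

open Literature.NumberTheory.Transcendental

namespace Summit.KontsevichZagierPeriods.FurushoPentagon.PentagonInKZNegative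

open Summit.KontsevichZagierPeriods.KontsevichZagierPeriods.Theses.FurushoPentagon (PentagonInKZ)

/-! ## §13 The crux IS the pentagon for the rules associator over `P_ℚ` (tree-visible form of the
planner's `Equiv2.lean`) -/

section RulesAssociator

open scoped TensorProduct

/-- The crux series does not depend on the choice of the agreeing assignment `Z`. [folklore] -/
theorem cruxSeries_congr_Z {R : Type} [CommRing R] [Algebra ℚ R] (χ : KZ.FormalRep →+ R)
    {Z Z' : List ℕ → KZ.FormalRep} (hZ : AgreesWithSimplex Z) (hZ' : AgreesWithSimplex Z') :
    cruxSeries R χ Z = cruxSeries R χ Z' := by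
  funext W
  rw [cruxSeries, cruxSeries]
  congr 1
  refine Finsupp.sum_congr fun v hv => ?_
  have hconv := MZV.isConvergentWord_of_mem_support_shuffleReg hv
  have hadm := MZV.isAdmissible_ofBinaryWord_of_isConvergentWord hconv
  rw [if_pos hconv, if_pos hconv, hZ _ hadm, hZ' _ hadm]

/-- **The universal realisation** `χ₀ : FormalRep → P → P_ℚ = ℚ ⊗ (FormalRep ⧸ relations)`.
[cite: KontsevichZagier2001, §4.1] -/
def chiUniv : KZ.FormalRep →+ KZ.FormalPeriodAlgebra :=
  KZ.toPeriodAlgebra.toRingHom.toAddMonoidHom.comp KZ.toFormalPeriod.toAddMonoidHom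

/-- `χ₀ c = 1 ⊗ ⟦c⟧`. [folklore] -/
theorem chiUniv_apply (c : KZ.FormalRep) :
    chiUniv c = KZ.toPeriodAlgebra (KZ.toFormalPeriod c) := rfl

/-- The universal realisation is a realisation. [cite: KontsevichZagier2001, §4.1] -/
theorem isRealisation_chiUniv : IsRealisation KZ.FormalPeriodAlgebra chiUniv where
  rel c hc := by rw [chiUniv_apply, KZ.toFormalPeriod_eq_zero_of_mem hc, map_zero]
  mul a b := by rw [chiUniv_apply, chiUniv_apply, chiUniv_apply, map_mul, map_mul]
  unit := ⟨KZ.of KZ.IntegralRep.unit, by rw [chiUniv_apply, KZ.toFormalPeriod_of_unit, map_one]⟩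

/-- **At the universal realisation the crux series is the rules associator `Φ_P`.**
[cite: Furusho2003, Prop. 3.2.3] -/
theorem cruxSeries_chiUniv : cruxSeries KZ.FormalPeriodAlgebra chiUniv simplexZ = KZ.rulesAssociator := by
  funext W
  rw [KZ.rulesAssociator_apply, KZ.wordDepth, KZ.zetaClass, KZ.zetaFS,
    Finsupp.linearCombination_apply, cruxSeries]
  congr 1
  refine Finsupp.sum_congr fun v hv => ?_
  have hconv := MZV.isConvergentWord_of_mem_support_shuffleReg hv
  rw [if_pos hconv, KZ.zetaConv_of_isConvergentWord hconv, chiUniv_apply,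
    KZ.toFormalPeriod_eq_mzvClass simplexZ_agrees
      (MZV.isAdmissible_ofBinaryWord_of_isConvergentWord hconv)]

/-- **Descent of a realisation to the formal period ring** `P → R`, `⟦c⟧ ↦ χ c`. [cite: KontsevichZagier2001, §4.1] -/
def descend {R : Type} [CommRing R] (χ : KZ.FormalRep →+ R) (hχ : IsRealisation R χ) :
    KZ.FormalPeriodRing →+* R where
  toFun := Quotient.lift (χ : KZ.FormalRep → R) fun a b (h : KZ.ringCon a b) => by
    rw [KZ.ringCon_apply] at h
    have h0 := hχ.rel _ h
    rwa [map_sub, sub_eq_zero] at h0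
  map_one' := by
    change χ (KZ.of KZ.IntegralRep.unit) = 1
    exact chi_unit hχ
  map_mul' x y := by
    induction x using Quotient.inductionOn' with | h c => ?_
    induction y using Quotient.inductionOn' with | h d => ?_
    exact hχ.mul c d
  map_zero' := by
    change χ (0 : KZ.FormalRep) = 0
    exact map_zero χ
  map_add' x y := by
    induction x using Quotient.inductionOn' with | h c => ?_
    induction y using Quotient.inductionOn' with | h d => ?_
    exact map_add χ c d

/-- `descend χ ⟦c⟧ = χ c`. [folklore] -/
@[simp] theorem descend_toFormalPeriod {R : Type} [CommRing R] (χ : KZ.FormalRep →+ R)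
    (hχ : IsRealisation R χ) (c : KZ.FormalRep) : descend χ hχ (KZ.toFormalPeriod c) = χ c := rfl

/-- **Descent to `P_ℚ`**: `a ⊗ ⟦c⟧ ↦ a · χ c`. [cite: KontsevichZagier2001, §4.1] -/
def descendQ {R : Type} [CommRing R] [Algebra ℚ R] (χ : KZ.FormalRep →+ R)
    (hχ : IsRealisation R χ) : KZ.FormalPeriodAlgebra →ₐ[ℚ] R :=
  Algebra.TensorProduct.lift (Algebra.ofId ℚ R) (descend χ hχ).toIntAlgHom fun _ _ => Commute.all _ _

/-- `descendQ χ (a ⊗ p) = a · descend χ p`. [folklore] -/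
@[simp] theorem descendQ_tmul {R : Type} [CommRing R] [Algebra ℚ R] (χ : KZ.FormalRep →+ R)
    (hχ : IsRealisation R χ) (a : ℚ) (p : KZ.FormalPeriodRing) :
    descendQ χ hχ (a ⊗ₜ[ℤ] p) = a • descend χ hχ p := by
  simp [descendQ, Algebra.smul_def]

/-- `descendQ χ ∘ χ₀ = χ`. [folklore] -/
theorem descendQ_comp_chiUniv {R : Type} [CommRing R] [Algebra ℚ R] (χ : KZ.FormalRep →+ R)
    (hχ : IsRealisation R χ) :
    (descendQ χ hχ).toRingHom.toAddMonoidHom.comp chiUniv = χ := by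
  refine AddMonoidHom.ext fun c => ?_
  change descendQ χ hχ (chiUniv c) = χ c
  rw [chiUniv_apply, KZ.toPeriodAlgebra_apply, descendQ_tmul, one_smul, descend_toFormalPeriod]

/-- **THE CRUX IS THE PENTAGON FOR THE RULES ASSOCIATOR**:
`PentagonInKZ ↔ NCSeries.DrinfeldPentagon KZ.rulesAssociator` (`Φ_P` over
`P_ℚ = ℚ ⊗ (FormalRep ⧸ relations)`, `KZRulesAssociator.lean`).  (⇒) the universal realisation
`χ₀` is a realisation and its series is `Φ_P`; (⇐) every realisation `χ` factors as
`descendQ χ ∘ χ₀`, the series is natural in `χ` (`cruxSeries_comp`), and the pentagon is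
preserved by change of coefficients.  A prover may therefore work over `P_ℚ`. [cite: Furusho2011, §2] -/
theorem pentagonInKZ_iff_rulesAssociator :
    PentagonInKZ ↔ NCSeries.DrinfeldPentagon KZ.rulesAssociator := by
  constructor
  · intro h
    rw [← cruxSeries_chiUniv]
    exact (pentagonInKZ_iff'.mp h) _ chiUniv isRealisation_chiUniv simplexZ simplexZ_agrees
  · intro hP
    rw [pentagonInKZ_iff']
    intro R _ _ χ hχ Z hZ
    rw [cruxSeries_congr_Z χ hZ simplexZ_agrees, ← descendQ_comp_chiUniv χ hχ, cruxSeries_comp,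
      cruxSeries_chiUniv]
    exact hP.map _

/-- Corollary: **the summit implies the pentagon for the rules associator `Φ_P` over `P_ℚ`.**
[folklore] -/
theorem rulesAssociator_pentagon_of_summit (h : KontsevichZagierPeriods) :
    NCSeries.DrinfeldPentagon KZ.rulesAssociator :=
  pentagonInKZ_iff_rulesAssociator.mp (pentagonInKZ_of_summit h)

end RulesAssociator


end Summit.KontsevichZagierPeriods.FurushoPentagon.PentagonInKZNegative
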